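import Mathlib
import HarnessLib
import Literature.MathematicalPhysics.StatisticalMechanics.RenormalisationMapBlockTermsQ
import Literature.MathematicalPhysics.StatisticalMechanics.StepOperatorAKernelSub
import Literature.MathematicalPhysics.StatisticalMechanics.PolymerProductABKM
import Literature.MathematicalPhysics.StatisticalMechanics.RenormalisationMapZero
import Literature.MathematicalPhysics.StatisticalMechanics.NextHamiltonianBounds

/-!
# The block bracket `Φ_B(𝒞, H, V)` of `Σ₁` for TWO STEP KERNELS at fixed `(H, V)`: the kernel-only piece
# ([ABKM19] Theorem 6.8 (6.56), (6.61)–(6.64) ⊗ Lemma 8.4; (12.53) preparation)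

In the block sum `Σ₁` of the decomposition of `S_k` ([ABKM19] (6.59)–(6.60)) every block `B` carries the bracket
`Φ_B(𝒞, H, V) = D_B(𝒞, H) + (e^{−A(𝒞)H(B)} − 1)(1 − e^{−V(B)}) − (e^{−V(B)} − 1 + V(B))`, `D_B` the fluctuation
defect `R_𝒞 e^{−H(B)} − e^{−A(𝒞)H(B)}` (`fluctDefect`), `A(𝒞) = stepOpA (gradCov 𝒞)`.  Its one-kernel Lipschitz bound in
`(H, V)` is `RenormalisationMapBlockTermsQ.tayNormLE_blockBracket_sub_abkm_of_stepKernelBounds`.  For the volume-uniform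
two-kernel comparison of `S_k` (child `TwoKernelSkBound` of the cruxes `HypACumulant` / `HypALocalTwoPoint` of the route
`Summits/HubbardSuperconductivity/…/Theses/ComplexGFFStiffness`, line `banach_two_kernel`, `Σ₁` twin) one also needs the
KERNEL-ONLY piece at FIXED `(H, V)`:
`Φ_B(𝒞a,H,V) − Φ_B(𝒞b,H,V) = (R_a − R_b)(e^{−H(B)} − 1) − (e^{−A_aH(B)} − e^{−A_bH(B)}) − (e^{−A_aH(B)} − e^{−A_bH(B)})(e^{−V(B)} − 1)`
(`(R_a − R_b)1 = 0`; the `V`-bracket cancels):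

* **`tayNormLE_blockBracket_kernelOnly_sub_abkm_of_stepKernelBounds`** — in `|·|_{T_k^{B*}, w_{k:k+1}^B}` the
  difference is at most `8e^{1/4}‖H‖·ℓ·κ_p + 16e^{3/8}(δ_γ/h²)‖H‖ + 256e^{1/4}·(2(δ_γ/h²)‖H‖)·‖V‖`, from the pair
  property of Lemma 8.4 on the block (`‖(R_a − R_b)F‖ ≤ b·ℓ·κ_p^{|X|_k}`), `L^{dk}|γ_q(𝒞a) − γ_q(𝒞b)| ≤ δ_γ`
  (`hamNorm_stepOpA_sub_abkm_le`) and Lemma 9.3 (`StrongNormExpLipschitz`, `StrongNormExpDifferenceProduct`).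

First order in `‖H‖` times the kernel-difference sizes `ℓ`, `δ_γ` — the shape the `Σ₁` slot lemmas consume.
Everything is proved; no named fact.

## References
* S. Adams, S. Buchholz, R. Kotecký, S. Müller, arXiv:1910.13564, Theorem 6.8 ((6.56), (6.61)–(6.64)), Lemma 8.4,
  Lemma 9.3, Lemma 12.6 (12.53) [AdamsBuchholzKoteckyMuller2019].
-/

noncomputable section

namespace Literature.MathematicalPhysics.StatisticalMechanics.GradientRG

open scoped BigOperators Classical
open Finset MeasureTheory
open Literature.MathematicalPhysics.StatisticalMechanics.TorusPolymer
  (IsPolymer blocks polys bprod blockOf thicken mem_blocks numBlocks isPolymer_blockOf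
    card_blocks_eq_numBlocks blocks_blockOf subset_thicken card_blockOf)
open Literature.Barriers.CriticalPhenomena.LongRangePhi4.Polymer (IsConn components)
open Literature.MathematicalPhysics.QuantumFieldTheory

variable {d M : ℕ} [NeZero M]

set_option maxHeartbeats 800000 in
/-- **Kernel-only two-kernel bound of the block bracket** (module docstring): torus data at scale `k ≤ N`
(`d ≥ 2`, `L` odd, `M = L^N`, `θ̄, λ, δ₀, δ₁ > 0`, `h² ≥ h₀²`, `⌊d/2⌋+1 ≤ min(p, M_ord)`), two step kernels `𝒞a, 𝒞b`
with `StepKernelBounds` relative to the `q = 0` weights, shifts `L^{dk}|γ_q(𝒞a)| ≤ h²`, `L^{dk}|γ_q(𝒞b)| ≤ h²` and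
`L^{dk}|γ_q(𝒞a) − γ_q(𝒞b)| ≤ δ_γ`, the pair property of Lemma 8.4 on connected `k`-polymers with constant
`b·ℓ·κ_p^{|X|_k}`; `‖H‖_{k,0} ≤ 1/64`, `‖V‖_{k,0} ≤ 1/64`.  On the block `B = B_x`:
`|Φ_B(𝒞a,H,V) − Φ_B(𝒞b,H,V)|_{T_k^{B*}, w_{k:k+1}^B} ≤ 8e^{1/4}‖H‖ℓκ_p + 16e^{3/8}(δ_γ/h²)‖H‖ + 256e^{1/4}(2(δ_γ/h²)‖H‖)‖V‖`.
[cite: AdamsBuchholzKoteckyMuller2019, Theorem 6.8 ((6.56), (6.61)–(6.64)) / Lemma 8.4 / Lemma 9.3] -/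
theorem tayNormLE_blockBracket_kernelOnly_sub_abkm_of_stepKernelBounds {L N Mord R n p r₀ : ℕ}
    {θbar lam μ δ₁ δ₀ A𝒫 A𝒫a A𝒫b C₂a C₂b h A : ℝ}
    {𝒞 : ℕ → (Fin d → ZMod M) → ℝ} (hd : 2 ≤ d)
    (hB : AbkmWeightBounds L N Mord R n θbar lam μ δ₁ δ₀ A𝒫 𝒞
      (abkmWeightData L N Mord R θbar (schedDelta δ₀ δ₁ N) 𝒞))
    (hLodd : Odd L) (hM : M = L ^ N) {k : ℕ} (hk : k ≤ N)
    {𝒞a 𝒞b : (Fin d → ZMod M) → ℝ}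
    (hSa : StepKernelBounds (abkmWeightData L N Mord R θbar (schedDelta δ₀ δ₁ N) 𝒞) L k A𝒫a C₂a 𝒞a)
    (hSb : StepKernelBounds (abkmWeightData L N Mord R θbar (schedDelta δ₀ δ₁ N) 𝒞) L k A𝒫b C₂b 𝒞b)
    (hδ₀ : 0 < δ₀) (hδ₁ : 0 < δ₁) (hh : 0 < h)
    (hh0 : hZeroSq d R δ₀ δ₁ ≤ h ^ 2) (hMord : d / 2 + 1 ≤ Mord) (hp : d / 2 + 1 ≤ p)
    (hγa : ∀ q, ((L ^ (d * k) : ℕ) : ℝ) * |gradCov 𝒞a q| ≤ h ^ 2)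
    (hγb : ∀ q, ((L ^ (d * k) : ℕ) : ℝ) * |gradCov 𝒞b q| ≤ h ^ 2)
    {δγ : ℝ} (hδγ : 0 ≤ δγ)
    (hγab : ∀ q, ((L ^ (d * k) : ℕ) : ℝ) * |gradCov 𝒞a q - gradCov 𝒞b q| ≤ δγ)
    {ℓ κp : ℝ}
    (hdiff : ∀ X : Finset (Fin d → ZMod M), IsPolymer (L ^ k) X → IsConn X →
      ∀ (F : ((Fin d → ZMod M) → ℝ) → ℂ) (b : ℝ), 0 ≤ b → ContDiff ℝ r₀ F →
        IsGaugeLocal ((abkmNormParams L N Mord R p r₀ h θbar A (schedDelta δ₀ δ₁ N) 𝒞).gauge k X) F →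
        TayNormLE ((abkmNormParams L N Mord R p r₀ h θbar A (schedDelta δ₀ δ₁ N) 𝒞).gauge k X) r₀
          ((abkmWeightData L N Mord R θbar (schedDelta δ₀ δ₁ N) 𝒞).weight k X) F b →
          TayNormLE ((abkmNormParams L N Mord R p r₀ h θbar A (schedDelta δ₀ δ₁ N) 𝒞).gauge k X) r₀
            ((abkmWeightData L N Mord R θbar (schedDelta δ₀ δ₁ N) 𝒞).midWeight k X)
            (fluct 𝒞a F - fluct 𝒞b F) (b * ℓ * κp ^ numBlocks (L ^ k) X))
    (x : Fin d → ZMod M) {H V : RelevantHamiltonian ℂ d}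
    (hH : hamNorm (fieldWt h (L : ℝ) d k) ((L : ℝ) ^ k) (L ^ (d * k)) H ≤ 1 / 64)
    (hV : hamNorm (fieldWt h (L : ℝ) d k) ((L : ℝ) ^ k) (L ^ (d * k)) V ≤ 1 / 64) :
    TayNormLE ((abkmNormParams L N Mord R p r₀ h θbar A (schedDelta δ₀ δ₁ N) 𝒞).gauge k (blockOf (L ^ k) x))
      r₀ ((abkmWeightData L N Mord R θbar (schedDelta δ₀ δ₁ N) 𝒞).midWeight k (blockOf (L ^ k) x))
      (fun φ => (fluctDefect 𝒞a H (blockOf (L ^ k) x) φ +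
          (expNegH (stepOpA (gradCov 𝒞a) H) (blockOf (L ^ k) x) φ - 1) *
            (1 - Complex.exp (-(eval V (blockOf (L ^ k) x) φ))) -
          (Complex.exp (-(eval V (blockOf (L ^ k) x) φ)) - 1 + eval V (blockOf (L ^ k) x) φ)) -
        (fluctDefect 𝒞b H (blockOf (L ^ k) x) φ +
          (expNegH (stepOpA (gradCov 𝒞b) H) (blockOf (L ^ k) x) φ - 1) *
            (1 - Complex.exp (-(eval V (blockOf (L ^ k) x) φ))) -
          (Complex.exp (-(eval V (blockOf (L ^ k) x) φ)) - 1 + eval V (blockOf (L ^ k) x) φ)))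
      (8 * Real.exp (1 / 4) * hamNorm (fieldWt h (L : ℝ) d k) ((L : ℝ) ^ k) (L ^ (d * k)) H * ℓ * κp +
        16 * Real.exp (3 / 8) * (δγ / h ^ 2 * hamNorm (fieldWt h (L : ℝ) d k) ((L : ℝ) ^ k) (L ^ (d * k)) H) +
        256 * Real.exp (1 / 4) * (2 * (δγ / h ^ 2 * hamNorm (fieldWt h (L : ℝ) d k) ((L : ℝ) ^ k) (L ^ (d * k)) H)) *
          hamNorm (fieldWt h (L : ℝ) d k) ((L : ℝ) ^ k) (L ^ (d * k)) V) := by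
  set P := abkmNormParams L N Mord R p r₀ h θbar A (schedDelta δ₀ δ₁ N) 𝒞 with hP
  set W := abkmWeightData L N Mord R θbar (schedDelta δ₀ δ₁ N) 𝒞 with hW
  set B := blockOf (L ^ k) x with hBdef
  set AHa := stepOpA (gradCov 𝒞a) H with hAHa
  set AHb := stepOpA (gradCov 𝒞b) H with hAHb
  set nH := hamNorm (fieldWt h (L : ℝ) d k) ((L : ℝ) ^ k) (L ^ (d * k)) H with hnH
  set nV := hamNorm (fieldWt h (L : ℝ) d k) ((L : ℝ) ^ k) (L ^ (d * k)) V with hnV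
  have hL0 : (0 : ℝ) < L := by exact_mod_cast hLodd.pos
  have hL1 : 1 ≤ L := hLodd.pos
  obtain ⟨t, ht⟩ : ∃ t, N = k + t := ⟨N - k, by omega⟩
  have hMt : M = L ^ k * L ^ t := by rw [← pow_add, ← ht]; exact hM
  have hMo : Odd M := by rw [hM]; exact hLodd.pow
  have hcard : B.card = L ^ (d * k) := by
    rw [hBdef, card_blockOf hMt hLodd.pow hLodd.pow x, ← pow_mul, mul_comm]
  have h𝔥 : 0 < fieldWt h (L : ℝ) d k := fieldWt_pos hh hL0 d k
  have hRk : (0 : ℝ) < (L : ℝ) ^ k := by positivity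
  have hnn : ∀ G : RelevantHamiltonian ℂ d, 0 ≤ hamNorm (fieldWt h (L : ℝ) d k) ((L : ℝ) ^ k) (L ^ (d * k)) G :=
    fun G => hamNorm_nonneg h𝔥.le hRk.le _ _
  have hnH0 : 0 ≤ nH := hnn H
  have hnV0 : 0 ≤ nV := hnn V
  have hh2 : 0 < h ^ 2 := by positivity
  -- norms of `A_a H`, `A_b H`, `A_a H − A_b H`
  have hAHa2 : hamNorm (fieldWt h (L : ℝ) d k) ((L : ℝ) ^ k) (L ^ (d * k)) AHa ≤ 2 * nH :=
    hamNorm_stepOpA_abkm_le hd hL1 hh k hγa H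
  have hAHb2 : hamNorm (fieldWt h (L : ℝ) d k) ((L : ℝ) ^ k) (L ^ (d * k)) AHb ≤ 2 * nH :=
    hamNorm_stepOpA_abkm_le hd hL1 hh k hγb H
  have hAΔ : hamNorm (fieldWt h (L : ℝ) d k) ((L : ℝ) ^ k) (L ^ (d * k)) (AHa - AHb) ≤ δγ / h ^ 2 * nH :=
    hamNorm_stepOpA_sub_abkm_le hd hL1 hh hδγ k hγab H
  have hnA0 : 0 ≤ hamNorm (fieldWt h (L : ℝ) d k) ((L : ℝ) ^ k) (L ^ (d * k)) (AHa - AHb) := hnn _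
  have hBS : B ⊆ thicken (P.rad k) B := subset_thicken _ _
  have hgauge : P.gauge k B = fieldGauge (fieldWt h (L : ℝ) d k) ((L : ℝ) ^ k) p (thicken (P.rad k) B) := rfl
  have hPB : IsPolymer (L ^ k) B := isPolymer_blockOf _ x
  have hcB : IsConn B := TorusPolymer.isConn_blockOf hMo hLodd.pow x
  have hnB : numBlocks (L ^ k) B = 1 := by
    rw [← card_blocks_eq_numBlocks, hBdef, blocks_blockOf, card_singleton]
  -- weights: strong ≤ weak ≤ mid
  have hSW : ∀ φ, expWeight (strongCoef h N k • derivForm (L : ℝ) k (diffIndex d Mord)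
      (boxDensity (boxRad R L k) (boxWt (L : ℝ) d k) B)) φ ≤ W.weight k B φ :=
    fun φ => strongWeight_le_weight_abkm hB hδ₀ hδ₁ hh hh0 k (subset_refl B) φ
  have hwm : ∀ φ, W.weight k B φ ≤ W.midWeight k B φ := fun φ =>
    WeightData.weight_le_midWeight hB.dominated k B φ
  have hev : ∀ G : RelevantHamiltonian ℂ d, IsGaugeLocal (P.gauge k B)
      (fun φ : (Fin d → ZMod M) → ℝ => eval G B φ) := fun G => by
    rw [hgauge]; exact isGaugeLocal_eval h𝔥.ne' hRk.ne' hp hBS G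
  have hexp_loc : ∀ G : RelevantHamiltonian ℂ d, IsGaugeLocal (P.gauge k B) (expNegH G B) :=
    fun G φ ψ hT => by simp only [expNegH, hev G φ ψ hT]
  have hexp_d : ∀ G : RelevantHamiltonian ℂ d, ContDiff ℝ r₀ (expNegH G B) := fun G => by
    show ContDiff ℝ r₀ (fun φ : (Fin d → ZMod M) → ℝ => Complex.exp (-(eval G B φ)))
    exact (contDiff_eval G B (n := r₀)).neg.cexp
  have hsub1_d : ∀ G : RelevantHamiltonian ℂ d, ContDiff ℝ r₀ (fun φ => expNegH G B φ - 1) :=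
    fun G => (hexp_d G).sub contDiff_const
  have hsub1_loc : ∀ G : RelevantHamiltonian ℂ d, IsGaugeLocal (P.gauge k B) (fun φ => expNegH G B φ - 1) :=
    fun G φ ψ hT => by simp only [hexp_loc G φ ψ hT]
  -- (1) the pair property on `G = e^{−H(B)} − 1`
  set G : ((Fin d → ZMod M) → ℝ) → ℂ := fun ψ => expNegH H B ψ - 1 with hGdef
  have hHB8 : hamNorm (fieldWt h (L : ℝ) d k) ((L : ℝ) ^ k) B.card H ≤ 1 / 8 := by rw [hcard]; linarith
  have hGs := tayNormLE_expNegH_sub_one_strong_abkm (R := R) (Mord := Mord) hd hLodd hM hk hh hMord hp hBS r₀ hHB8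
  rw [← hgauge, hcard] at hGs
  have hb0 : 0 ≤ 8 * Real.exp (1 / 4) * nH := by positivity
  have hGw : TayNormLE (P.gauge k B) r₀ (W.weight k B) G (8 * Real.exp (1 / 4) * nH) := hGs.mono_weight hb0 hSW
  have hD₁ : TayNormLE (P.gauge k B) r₀ (W.midWeight k B) (fluct 𝒞a G - fluct 𝒞b G)
      (8 * Real.exp (1 / 4) * nH * ℓ * κp) := by
    have h1 := hdiff B hPB hcB G _ hb0 (hsub1_d H) (hsub1_loc H) hGw
    rw [hnB, pow_one] at h1
    exact h1
  have hD₁d : ContDiff ℝ r₀ (fluct 𝒞a G - fluct 𝒞b G) :=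
    (hSa.contDiff_fluct hB.dominated B (P.gauge k B) hb0 (hsub1_d H) (hsub1_loc H) hGw).sub
      (hSb.contDiff_fluct hB.dominated B (P.gauge k B) hb0 (hsub1_d H) (hsub1_loc H) hGw)
  -- `R_a e^{−H(B)} − R_b e^{−H(B)} = R_a G − R_b G` (`R 1 = 1`)
  have hIexp : ∀ (𝒞q : (Fin d → ZMod M) → ℝ) {A𝒫q C₂q : ℝ},
      StepKernelBounds W L k A𝒫q C₂q 𝒞q → ∀ φ, Integrable (fun ξ => expNegH H B (φ + ξ)) (stepMeasure 𝒞q) := by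
    intro 𝒞q A𝒫q C₂q hS φ
    have hs := tayNormLE_expNegH_strong_abkm (R := R) (Mord := Mord) hd hLodd hM hk hh hMord hp hBS r₀ hHB8
    rw [← hgauge] at hs
    exact hS.integrable_comp_add hB.dominated B (P.gauge k B) (Real.exp_pos _).le (hexp_d H) (hexp_loc H)
      (hs.mono_weight (Real.exp_pos _).le hSW) φ
  have hI1 : ∀ (𝒞q : (Fin d → ZMod M) → ℝ) (φ : (Fin d → ZMod M) → ℝ),
      Integrable (fun ξ => (fun _ : (Fin d → ZMod M) → ℝ => (1 : ℂ)) (φ + ξ)) (stepMeasure 𝒞q) := by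
    intro 𝒞q φ
    haveI := isProbabilityMeasure_stepMeasure 𝒞q
    exact integrable_const _
  have hfluctG : ∀ (𝒞q : (Fin d → ZMod M) → ℝ) {A𝒫q C₂q : ℝ}, StepKernelBounds W L k A𝒫q C₂q 𝒞q →
      fluct 𝒞q (expNegH H B) = fluct 𝒞q G + fun _ => (1 : ℂ) := by
    intro 𝒞q A𝒫q C₂q hS
    have hGe : G = expNegH H B - fun _ => (1 : ℂ) := by funext ψ; rfl
    rw [hGe, fluct_sub_of_integrable (hIexp 𝒞q hS) (hI1 𝒞q), fluct_const]
    abel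
  -- (2) `e^{−A_aH(B)} − e^{−A_bH(B)}`
  have hAHaB : hamNorm (fieldWt h (L : ℝ) d k) ((L : ℝ) ^ k) B.card AHa ≤ 1 / 16 := by rw [hcard]; linarith
  have hAHbB : hamNorm (fieldWt h (L : ℝ) d k) ((L : ℝ) ^ k) B.card AHb ≤ 1 / 16 := by rw [hcard]; linarith
  have hD₂s := tayNormLE_expNegH_sub_strong_abkm (R := R) (Mord := Mord) hd hLodd hM hk hh hMord hp hBS r₀ hAHaB hAHbB
  rw [← hgauge, hcard] at hD₂s
  have hc₂ : 0 ≤ 16 * Real.exp (3 / 8) * hamNorm (fieldWt h (L : ℝ) d k) ((L : ℝ) ^ k) (L ^ (d * k)) (AHa - AHb) := by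
    positivity
  have hD₂ : TayNormLE (P.gauge k B) r₀ (W.midWeight k B)
      (fun ψ : (Fin d → ZMod M) → ℝ => expNegH AHa B ψ - expNegH AHb B ψ)
      (16 * Real.exp (3 / 8) * hamNorm (fieldWt h (L : ℝ) d k) ((L : ℝ) ^ k) (L ^ (d * k)) (AHa - AHb)) :=
    (hD₂s.mono_weight hc₂ hSW).mono_weight hc₂ hwm
  have hD₂d : ContDiff ℝ r₀ (fun ψ : (Fin d → ZMod M) → ℝ => expNegH AHa B ψ - expNegH AHb B ψ) :=
    (hexp_d AHa).sub (hexp_d AHb)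
  -- (3) the mixed atom `(e^{−A_aH} − e^{−A_bH})(e^{−V} − 1)`
  set M₁ : ((Fin d → ZMod M) → ℝ) → ℂ := fun ψ => (expNegH AHa B ψ - expNegH AHb B ψ) * (expNegH V B ψ - 1)
    with hM₁
  have hM₁s := tayNormLE_expNegH_sub_mul_sub_one_strong_abkm (R := R) (Mord := Mord) hd hLodd hM hk hh hMord hp
    hBS r₀ (H₁ := AHa) (H₂ := AHb) (H₃ := V) (by rw [hcard]; linarith) (by rw [hcard]; linarith)
    (by rw [hcard]; linarith)
  rw [← hgauge, hcard] at hM₁s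
  have hc₃ : 0 ≤ 256 * Real.exp (1 / 4) * hamNorm (fieldWt h (L : ℝ) d k) ((L : ℝ) ^ k) (L ^ (d * k)) (AHa - AHb) *
      nV := by positivity
  have hM₁w : TayNormLE (P.gauge k B) r₀ (W.midWeight k B) M₁
      (256 * Real.exp (1 / 4) * hamNorm (fieldWt h (L : ℝ) d k) ((L : ℝ) ^ k) (L ^ (d * k)) (AHa - AHb) * nV) :=
    (hM₁s.mono_weight hc₃ hSW).mono_weight hc₃ hwm
  have hM₁d : ContDiff ℝ r₀ M₁ := ((hexp_d AHa).sub (hexp_d AHb)).mul (hsub1_d V)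
  -- the pointwise identity
  have heq : (fun φ => (fluctDefect 𝒞a H B φ +
          (expNegH (stepOpA (gradCov 𝒞a) H) B φ - 1) * (1 - Complex.exp (-(eval V B φ))) -
          (Complex.exp (-(eval V B φ)) - 1 + eval V B φ)) -
        (fluctDefect 𝒞b H B φ +
          (expNegH (stepOpA (gradCov 𝒞b) H) B φ - 1) * (1 - Complex.exp (-(eval V B φ))) -
          (Complex.exp (-(eval V B φ)) - 1 + eval V B φ))) =
      (fluct 𝒞a G - fluct 𝒞b G) +
        (((-1 : ℝ) • fun ψ : (Fin d → ZMod M) → ℝ => expNegH AHa B ψ - expNegH AHb B ψ) + (-1 : ℝ) • M₁) := by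
    funext φ
    simp only [Pi.add_apply, Pi.sub_apply, Pi.smul_apply]
    simp only [neg_one_smul, hM₁, fluctDefect, hAHa, hAHb]
    rw [hfluctG 𝒞a hSa, hfluctG 𝒞b hSb]
    simp only [Pi.add_apply, expNegH]
    ring
  rw [heq]
  have h23 := (hD₂.smul hD₂d (-1)).add (hM₁w.smul hM₁d (-1)) (hD₂d.const_smul (-1 : ℝ)) (hM₁d.const_smul (-1 : ℝ))
  have hsum := hD₁.add h23 hD₁d ((hD₂d.const_smul (-1 : ℝ)).add (hM₁d.const_smul (-1 : ℝ)))
  refine hsum.mono ?_ (fun φ => (W.midWeight_pos k B φ).le)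
  simp only [abs_neg, abs_one, one_mul]
  have he2 : 0 ≤ 16 * Real.exp (3 / 8) := by positivity
  have he3 : 0 ≤ 256 * Real.exp (1 / 4) := by positivity
  have hb2 := mul_le_mul_of_nonneg_left hAΔ he2
  have hb3 : 256 * Real.exp (1 / 4) * hamNorm (fieldWt h (L : ℝ) d k) ((L : ℝ) ^ k) (L ^ (d * k)) (AHa - AHb) * nV ≤
      256 * Real.exp (1 / 4) * (2 * (δγ / h ^ 2 * nH)) * nV := by
    have h2 : hamNorm (fieldWt h (L : ℝ) d k) ((L : ℝ) ^ k) (L ^ (d * k)) (AHa - AHb) ≤ 2 * (δγ / h ^ 2 * nH) := by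
      have : 0 ≤ δγ / h ^ 2 * nH := by positivity
      linarith
    exact mul_le_mul_of_nonneg_right (mul_le_mul_of_nonneg_left h2 he3) hnV0
  linarith [hb2, hb3]

end Literature.MathematicalPhysics.StatisticalMechanics.GradientRG

end
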